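import Mathlib
import Summits.ValiantsHypothesis.ValiantsHypothesis.Theses.ValuativeGCT
import Summits.ValiantsHypothesis.ValiantsHypothesis.Theorems.ValuativeGCTValuativeFlipFirstRungBite
import Summits.ValiantsHypothesis.ValiantsHypothesis.Theorems.CutBites.Negative.NoCutInOddDegree

/-!
# `ValuativeGCT.ValuativeFlip` (stmt-ValiantsHypothesis-12624), det census — the first-rung bite along the
# route's centres `Λ_m` (`m` odd) and `Λ_3 ⊕ D_{m-3}` (every `m ≥ 3`), with admissibility

Companion of `ValuativeGCTValuativeFlipFirstRungBite` (`firstRung_bite_of_mem`: in degree `m · 2` the valuative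
truncation drops strictly at every threshold `t ≥ 1` along ANY centre containing a `3 × 3` skew triangle and an
invertible complementary block).  Instances on the route's centres, with their rank bounds, so that the strict
inequality holds in the crux's own currency `finrank T_U(δ(m-r), λ*) < finrank T_U(0, λ*)`, `δ = 2`, `r = m - 1`:

* `cutBites_firstRung_skewCentre` — `Λ_m`, `m` odd `≥ 3` (the crux `CutBites`' centre, its `let`-blocks verbatim
  with `δ = 2`): `CutBites` AT ITS FIRST RUNG (the tree's `CutBites_proof` sits at `δ = m - 1`; `δ = 2` is the first
  possible rung by `CutBites.Negative.cutBites_finrank_trunc_one_eq_of_odd` and was "true on paper" only).  Block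
  `Y = J = σ ⊗ 1` (symplectic: skew, `det = 1`); `skewCentre_rank_le`: odd skew matrices are singular.
* `firstRung_bite_cornerCentre` / `firstRung_admissibleCentre_bites` — `Λ_3 ⊕ D_{m-3}` (skew on three letters,
  diagonal elsewhere: the smallest Edmonds-gap padding of the `3 × 3` skew gap), EVERY `m ≥ 3`, even sizes included;
  admissible with `r = m - 1` (`cornerCentre_rank_le`: `det = det(skew₃) · det(diag) = 0`); `Y = 1`.  Hence at every
  size `m ≥ 3` the crux has an ADMISSIBLE centre whose degree-2 truncation at the crux's own threshold is strictly
  below the census space `T_U(0, λ*)` (the symmetric Kronecker space).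
The route's named even candidate `Λ_{m-1} ⊕ E_{mm}` is treated in `ValuativeGCTValuativeFlipFirstRungBiteEvenCentre`.

Det-census reading: with `K_m(λ*) ≤ K̃_m(λ*) ≤ dim T_U(2(m-r), λ*)` (`ValuativeBound`,
`ValuativeGCTValuativeFlipIntegralCutNormalization`) and `dim T_U(0, λ*) = sk(λ; 2^m)` (`stabInv_eq_explicit`), these
theorems certify `dim T_U < sk` somewhere in degree `2` at every `m ≥ 3`; the truncation being antitone in the centre
(`ValuativeGCTNoValuativeFlipMonotone`), every admissible centre containing one of these bites as well.

References: BLMW, SIAM J. Comput. 40 (2011) §5.2; M. Domokos, A. N. Zubkov, Transform. Groups 6 (2001) Thm. 1.1;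
Ivanyos–Qiao–Subrahmanyam, comput. complexity 27 (2018) (arXiv:1512.03531) (`Λ_3` has full non-commutative rank).
-/

namespace Summit.ValiantsHypothesis.ValiantsHypothesis.Theorems.ValuativeFlip

open Literature.NumberTheory.DiophantineGeometry Literature.Computability.AlgebraicComplexity
open MvPolynomial
open scoped BigOperators Matrix Kronecker

-- `Summit.ValiantsHypothesis.ValiantsHypothesis.…` is the tree's mandated single-conjunct layout (Sub = Summit).
set_option linter.dupNamespace false

noncomputable section

/-! ### §1 Linear algebra of the certificate rows -/

/-- A block-diagonal matrix with skew blocks, placed by `reindex e e`, is skew (entrywise form). [folklore] -/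
theorem frc_skew_reindex_fromBlocks {m : ℕ} {κ : Type*} (e : Fin 3 ⊕ κ ≃ Fin m) {A : Matrix (Fin 3) (Fin 3) ℂ}
    {D : Matrix κ κ ℂ} (hA : Aᵀ = -A) (hD : Dᵀ = -D) (a b : Fin m) :
    Matrix.reindex e e (Matrix.fromBlocks A 0 0 D) a b = -Matrix.reindex e e (Matrix.fromBlocks A 0 0 D) b a := by
  have h : (Matrix.reindex e e (Matrix.fromBlocks A 0 0 D))ᵀ = -Matrix.reindex e e (Matrix.fromBlocks A 0 0 D) := by
    rw [Matrix.transpose_reindex, Matrix.fromBlocks_transpose, hA, hD]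
    simp only [Matrix.transpose_zero]
    rw [show Matrix.fromBlocks (-A) 0 0 (-D) = -Matrix.fromBlocks A 0 0 D by
      simp only [Matrix.fromBlocks_neg, neg_zero]]
    simp only [Matrix.reindex_apply, Matrix.submatrix_neg, Pi.neg_apply]
  have := congr_fun (congr_fun h b) a
  simpa only [Matrix.transpose_apply, Matrix.neg_apply] using this

/-- `s_P = E₀₁ - E₁₀` is skew. [folklore] -/
theorem frc_sP_transpose : (!![0, 1, 0; -1, 0, 0; 0, 0, 0] : Matrix (Fin 3) (Fin 3) ℂ)ᵀ =
    -(!![0, 1, 0; -1, 0, 0; 0, 0, 0] : Matrix (Fin 3) (Fin 3) ℂ) := by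
  ext i j; fin_cases i <;> fin_cases j <;> simp

/-- `s_Q = E₀₂ - E₂₀` is skew. [folklore] -/
theorem frc_sQ_transpose : (!![0, 0, 1; 0, 0, 0; -1, 0, 0] : Matrix (Fin 3) (Fin 3) ℂ)ᵀ =
    -(!![0, 0, 1; 0, 0, 0; -1, 0, 0] : Matrix (Fin 3) (Fin 3) ℂ) := by
  ext i j; fin_cases i <;> fin_cases j <;> simp

/-- `s_R = E₁₂ - E₂₁` is skew. [folklore] -/
theorem frc_sR_transpose : (!![0, 0, 0; 0, 0, 1; 0, -1, 0] : Matrix (Fin 3) (Fin 3) ℂ)ᵀ =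
    -(!![0, 0, 0; 0, 0, 1; 0, -1, 0] : Matrix (Fin 3) (Fin 3) ℂ) := by
  ext i j; fin_cases i <;> fin_cases j <;> simp

/-- The standard symplectic block `J_{2k} = σ ⊗ 1_k`, `σ = [[0,1],[-1,0]]`, is skew. [folklore] -/
theorem frc_J_transpose (k : ℕ) :
    ((!![0, 1; -1, 0] : Matrix (Fin 2) (Fin 2) ℂ) ⊗ₖ (1 : Matrix (Fin k) (Fin k) ℂ))ᵀ =
      -((!![0, 1; -1, 0] : Matrix (Fin 2) (Fin 2) ℂ) ⊗ₖ (1 : Matrix (Fin k) (Fin k) ℂ)) := by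
  ext ⟨i, i'⟩ ⟨j, j'⟩
  simp only [Matrix.transpose_apply, Matrix.kroneckerMap_apply, Matrix.neg_apply, Matrix.one_apply]
  fin_cases i <;> fin_cases j <;> rcases eq_or_ne i' j' with h | h <;> simp [h, @eq_comm _ j' i']

/-- `det J_{2k} = 1`. [folklore] -/
theorem frc_J_det (k : ℕ) :
    ((!![0, 1; -1, 0] : Matrix (Fin 2) (Fin 2) ℂ) ⊗ₖ (1 : Matrix (Fin k) (Fin k) ℂ)).det = 1 := by
  rw [Matrix.det_kronecker, Matrix.det_one, one_pow, mul_one, Matrix.det_fin_two]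
  simp

/-- A singular square matrix of size `n ≥ 1` has rank at most `n - 1` (rank–nullity). [folklore] -/
theorem frc_rank_le_of_det_eq_zero {n : ℕ} (M : Matrix (Fin n) (Fin n) ℂ) (h : M.det = 0) :
    M.rank ≤ n - 1 := by
  classical
  obtain ⟨v, hv0, hv⟩ := Matrix.exists_mulVec_eq_zero_iff.mpr h
  have hker : v ∈ LinearMap.ker M.mulVecLin := by
    rw [LinearMap.mem_ker, Matrix.mulVecLin_apply, hv]
  have hrn := LinearMap.finrank_range_add_finrank_ker M.mulVecLin
  rw [Module.finrank_fin_fun] at hrn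
  have hpos : 0 < Module.finrank ℂ ↥(LinearMap.ker M.mulVecLin) := by
    refine Nat.pos_of_ne_zero fun h0 => hv0 ?_
    rw [Submodule.finrank_eq_zero] at h0
    rw [h0] at hker
    exact (Submodule.mem_bot ℂ).mp hker
  rw [Matrix.rank]
  omega

/-- An odd-size skew matrix is singular. [folklore] -/
theorem frc_det_eq_zero_of_skew {n : ℕ} (hn : Odd n) (S : Matrix (Fin n) (Fin n) ℂ) (hS : ∀ a b, S a b = -S b a) :
    S.det = 0 := by
  -- adapted from Cruxes/CutBites/Disproof.lean (`detRow_mem_vanI_of_odd`)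
  have hT : Sᵀ = -S := by
    ext a b
    simp only [Matrix.transpose_apply, Matrix.neg_apply]
    exact hS b a
  have h1 : S.det = (-1) ^ n * S.det := by
    conv_lhs => rw [← Matrix.det_transpose, hT, Matrix.det_neg]
    rw [Fintype.card_fin]
  rw [hn.neg_one_pow] at h1
  linear_combination h1 / 2

/-! ### §2 The skew centre `Λ_m`, `m` odd: `CutBites` at its first rung -/

/-- **`Λ_m` is an admissible centre with `r = m - 1` for odd `m`**: every matrix in the skew space has rank
`≤ m - 1` (skewness of span members: `CutBites.Negative.skew_of_mem_span_skew`). [folklore] -/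
theorem skewCentre_rank_le {m : ℕ} (hm : Odd m) :
    ∀ u ∈ Submodule.span ℂ {u : MatIdx m → ℂ | ∀ a b : Fin m, u (toLex (a, b)) = -u (toLex (b, a))},
      (Matrix.of fun a b : Fin m => u (toLex (a, b))).rank ≤ m - 1 := fun u hu =>
  frc_rank_le_of_det_eq_zero (Matrix.of fun a b : Fin m => u (toLex (a, b)))
    (frc_det_eq_zero_of_skew hm _ fun a b => CutBites.Negative.skew_of_mem_span_skew hu a b)

/-- **`CutBites` at its first rung.**  For every odd `m ≥ 3` there is `λ ⊢ 2m` (`≤ m²` parts) such that the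
valuative truncation along the skew Edmonds-gap centre `Λ_m` (the crux `CutBites`' own `let`-blocks, with
`δ = 2`) drops strictly at EVERY threshold `t ≥ 1`: `finrank T_Λ(t, λ*) < finrank T_Λ(0, λ*)`.  (`CutBites_proof`
has this at `δ = m - 1`; `δ = 2` is the first possible rung by `CutBites.Negative.cutBites_trunc_one_eq_trunc_zero_of_odd`.)
Certificate: `firstRung_bite_of_mem` with `κ = Fin 2 × Fin k`, `m = 3 + 2k`, `Y = J_{2k} = σ ⊗ 1_k` (`det = 1`,
skew), all four rows skew. [folklore] -/
theorem cutBites_firstRung_skewCentre (m : ℕ) (hm : Odd m) (h3 : 3 ≤ m) :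
    ∃ lam : Nat.Partition (m * 2), lam.parts.card ≤ m * m ∧
      (let U : Submodule ℂ (MatIdx m → ℂ) :=
        Submodule.span ℂ {u : MatIdx m → ℂ | ∀ a b : Fin m, u (toLex (a, b)) = -u (toLex (b, a))};
      let χ : Weight (MatIdx m) := (Weight.dualOfPartition (m * m) lam).toMatIdx;
      let T : ℕ → Submodule ℂ (MvPolynomial (MatIdx m × MatIdx m) ℂ) := fun t =>
        MvPolynomial.homogeneousSubmodule (MatIdx m × MatIdx m) ℂ (m * 2)
        ⊓ ((MvPolynomial.vanishingIdeal ℂ {p : MatIdx m × MatIdx m → ℂ |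
              ∀ j : MatIdx m, (fun i => p (j, i)) ∈ U}) ^ (t)).restrictScalars ℂ
        ⊓ (⨅ (M : Matrix (MatIdx m) (MatIdx m) ℂ)
            (_ : linSubst (MatIdx m) ℂ M (detFormLex ℂ m) = detFormLex ℂ m),
            LinearMap.ker ((MvPolynomial.aeval (R := ℂ) fun p : MatIdx m × MatIdx m =>
              ∑ l : MatIdx m, M l p.2 • MvPolynomial.X (p.1, l)).toLinearMap
              - LinearMap.id (R := ℂ) (M := MvPolynomial (MatIdx m × MatIdx m) ℂ)))
        ⊓ (⨅ (g : Matrix.GeneralLinearGroup (MatIdx m) ℂ) (_ : IsUpperTriangular g),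
            LinearMap.ker ((MvPolynomial.aeval (R := ℂ) fun p : MatIdx m × MatIdx m =>
              ∑ l : MatIdx m, ((g⁻¹ : Matrix.GeneralLinearGroup (MatIdx m) ℂ) :
                Matrix (MatIdx m) (MatIdx m) ℂ) p.1 l • MvPolynomial.X (l, p.2)).toLinearMap
              - weightChar χ g • LinearMap.id (R := ℂ) (M := MvPolynomial (MatIdx m × MatIdx m) ℂ)));
      ∀ t : ℕ, 0 < t → Module.finrank ℂ ↥(T t) < Module.finrank ℂ ↥(T 0)) := by
  obtain ⟨r, hr⟩ := hm
  obtain ⟨k, rfl⟩ : ∃ k, m = 3 + 2 * k := ⟨r - 1, by omega⟩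
  -- the placement `Fin 3 ⊕ (Fin 2 × Fin k) ≃ Fin (3 + 2k)` and the skew invertible block `J = σ ⊗ 1`
  set e : Fin 3 ⊕ (Fin 2 × Fin k) ≃ Fin (3 + 2 * k) :=
    (Equiv.sumCongr (Equiv.refl (Fin 3)) finProdFinEquiv).trans finSumFinEquiv with he
  set J : Matrix (Fin 2 × Fin k) (Fin 2 × Fin k) ℂ :=
    (!![0, 1; -1, 0] : Matrix (Fin 2) (Fin 2) ℂ) ⊗ₖ (1 : Matrix (Fin k) (Fin k) ℂ) with hJ
  have hJdet : J.det ≠ 0 := by rw [hJ, frc_J_det]; exact one_ne_zero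
  have hmem : ∀ {A : Matrix (Fin 3) (Fin 3) ℂ} {D : Matrix (Fin 2 × Fin k) (Fin 2 × Fin k) ℂ},
      Aᵀ = -A → Dᵀ = -D →
      (fun i : MatIdx (3 + 2 * k) => Matrix.reindex e e (Matrix.fromBlocks A 0 0 D) (ofLex i).1 (ofLex i).2) ∈
        Submodule.span ℂ {u : MatIdx (3 + 2 * k) → ℂ |
          ∀ a b : Fin (3 + 2 * k), u (toLex (a, b)) = -u (toLex (b, a))} := by
    intro A D hA hD
    refine Submodule.subset_span fun a b => ?_
    simp only [ofLex_toLex]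
    exact frc_skew_reindex_fromBlocks e hA hD a b
  have h0 : (0 : Matrix (Fin 2 × Fin k) (Fin 2 × Fin k) ℂ)ᵀ = -0 := by simp
  have h0' : (0 : Matrix (Fin 3) (Fin 3) ℂ)ᵀ = -0 := by simp
  obtain ⟨lam, hcard, hlt⟩ := firstRung_bite_of_mem e J hJdet _
    (hmem frc_sP_transpose h0) (hmem frc_sQ_transpose h0) (hmem frc_sR_transpose h0)
    (hmem h0' (by rw [hJ]; exact frc_J_transpose k))
  exact ⟨lam, hcard, hlt⟩


/-! ### §3 The centre `Λ_3 ⊕ D_{m-3}` (skew `3 × 3` corner, diagonal elsewhere) — every `m ≥ 3`, even `m` included -/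

/-- Splitting an index of `Fin (3 + k)` into a letter `castAdd k i` (`i < 3`) or a block index `natAdd 3 j`. [folklore] -/
theorem frc_fin_split (k : ℕ) (a : Fin (3 + k)) :
    (∃ i : Fin 3, a = Fin.castAdd k i) ∨ (∃ j : Fin k, a = Fin.natAdd 3 j) := by
  rcases h : finSumFinEquiv.symm a with i | j
  · left
    refine ⟨i, ?_⟩
    have := congrArg finSumFinEquiv h
    simpa using this
  · right
    refine ⟨j, ?_⟩
    have := congrArg finSumFinEquiv h
    simpa using this

/-- Entries of a block matrix placed by `finSumFinEquiv`: letter/letter. [folklore] -/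
theorem frc_entry_ll {k : ℕ} (A : Matrix (Fin 3) (Fin 3) ℂ) (B : Matrix (Fin 3) (Fin k) ℂ) (C : Matrix (Fin k) (Fin 3) ℂ)
    (D : Matrix (Fin k) (Fin k) ℂ) (i j : Fin 3) :
    Matrix.reindex finSumFinEquiv finSumFinEquiv (Matrix.fromBlocks A B C D) (Fin.castAdd k i) (Fin.castAdd k j) = A i j := by
  simp [Matrix.reindex_apply, Matrix.submatrix_apply]

/-- Entries of a block matrix placed by `finSumFinEquiv`: letter/block. [folklore] -/
theorem frc_entry_lb {k : ℕ} (A : Matrix (Fin 3) (Fin 3) ℂ) (B : Matrix (Fin 3) (Fin k) ℂ) (C : Matrix (Fin k) (Fin 3) ℂ)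
    (D : Matrix (Fin k) (Fin k) ℂ) (i : Fin 3) (j : Fin k) :
    Matrix.reindex finSumFinEquiv finSumFinEquiv (Matrix.fromBlocks A B C D) (Fin.castAdd k i) (Fin.natAdd 3 j) = B i j := by
  simp [Matrix.reindex_apply, Matrix.submatrix_apply]

/-- Entries of a block matrix placed by `finSumFinEquiv`: block/letter. [folklore] -/
theorem frc_entry_bl {k : ℕ} (A : Matrix (Fin 3) (Fin 3) ℂ) (B : Matrix (Fin 3) (Fin k) ℂ) (C : Matrix (Fin k) (Fin 3) ℂ)
    (D : Matrix (Fin k) (Fin k) ℂ) (i : Fin k) (j : Fin 3) :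
    Matrix.reindex finSumFinEquiv finSumFinEquiv (Matrix.fromBlocks A B C D) (Fin.natAdd 3 i) (Fin.castAdd k j) = C i j := by
  simp [Matrix.reindex_apply, Matrix.submatrix_apply]

/-- Entries of a block matrix placed by `finSumFinEquiv`: block/block. [folklore] -/
theorem frc_entry_bb {k : ℕ} (A : Matrix (Fin 3) (Fin 3) ℂ) (B : Matrix (Fin 3) (Fin k) ℂ) (C : Matrix (Fin k) (Fin 3) ℂ)
    (D : Matrix (Fin k) (Fin k) ℂ) (i j : Fin k) :
    Matrix.reindex finSumFinEquiv finSumFinEquiv (Matrix.fromBlocks A B C D) (Fin.natAdd 3 i) (Fin.natAdd 3 j) = D i j := by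
  simp [Matrix.reindex_apply, Matrix.submatrix_apply]

/-- Rows of the shape `A ⊕ D` (`A` skew `3 × 3` on the letters, `D` with zero off-diagonal) lie in the centre
`Λ_3 ⊕ D_{m-3} = span {u | u skew on the letters, u zero off the letters' block and off the diagonal}`. [folklore] -/
theorem frc_mem_cornerCentre {k : ℕ} {A : Matrix (Fin 3) (Fin 3) ℂ} {D : Matrix (Fin k) (Fin k) ℂ}
    (hA : ∀ i j, A i j = -A j i) (hD : ∀ i j, i ≠ j → D i j = 0) :
    (fun idx : MatIdx (3 + k) => Matrix.reindex finSumFinEquiv finSumFinEquiv (Matrix.fromBlocks A 0 0 D)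
        (ofLex idx).1 (ofLex idx).2) ∈
      Submodule.span ℂ {u : MatIdx (3 + k) → ℂ |
        (∀ a b : Fin (3 + k), (a : ℕ) < 3 → (b : ℕ) < 3 → u (toLex (a, b)) = -u (toLex (b, a))) ∧
        (∀ a b : Fin (3 + k), a ≠ b → (3 ≤ (a : ℕ) ∨ 3 ≤ (b : ℕ)) → u (toLex (a, b)) = 0)} := by
  refine Submodule.subset_span ⟨?_, ?_⟩
  · intro a b ha hb
    simp only [ofLex_toLex]
    rcases frc_fin_split k a with ⟨i, rfl⟩ | ⟨j, rfl⟩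
    · rcases frc_fin_split k b with ⟨i', rfl⟩ | ⟨j', rfl⟩
      · rw [frc_entry_ll, frc_entry_ll]
        exact hA i i'
      · simp at hb
    · simp at ha
  · intro a b hab h
    simp only [ofLex_toLex]
    rcases frc_fin_split k a with ⟨i, rfl⟩ | ⟨j, rfl⟩
    · rcases frc_fin_split k b with ⟨i', rfl⟩ | ⟨j', rfl⟩
      · exfalso
        simp at h
        omega
      · rw [frc_entry_lb]; rfl
    · rcases frc_fin_split k b with ⟨i', rfl⟩ | ⟨j', rfl⟩
      · rw [frc_entry_bl]; rfl
      · rw [frc_entry_bb]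
        exact hD j j' fun hjj => hab (by rw [hjj])

/-- Vectors in the corner centre satisfy its two (linear) defining conditions. [folklore] -/
theorem frc_cond_of_mem_cornerCentre {k : ℕ} {u : MatIdx (3 + k) → ℂ}
    (hu : u ∈ Submodule.span ℂ {u : MatIdx (3 + k) → ℂ |
        (∀ a b : Fin (3 + k), (a : ℕ) < 3 → (b : ℕ) < 3 → u (toLex (a, b)) = -u (toLex (b, a))) ∧
        (∀ a b : Fin (3 + k), a ≠ b → (3 ≤ (a : ℕ) ∨ 3 ≤ (b : ℕ)) → u (toLex (a, b)) = 0)}) :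
    (∀ a b : Fin (3 + k), (a : ℕ) < 3 → (b : ℕ) < 3 → u (toLex (a, b)) = -u (toLex (b, a))) ∧
    (∀ a b : Fin (3 + k), a ≠ b → (3 ≤ (a : ℕ) ∨ 3 ≤ (b : ℕ)) → u (toLex (a, b)) = 0) := by
  induction hu using Submodule.span_induction with
  | mem x hx => exact hx
  | zero => exact ⟨fun _ _ _ _ => by simp, fun _ _ _ _ => by simp⟩
  | add x y _ _ hx hy =>
      exact ⟨fun a b ha hb => by rw [Pi.add_apply, Pi.add_apply, hx.1 a b ha hb, hy.1 a b ha hb]; ring,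
        fun a b hab h => by rw [Pi.add_apply, hx.2 a b hab h, hy.2 a b hab h, add_zero]⟩
  | smul c x _ hx =>
      exact ⟨fun a b ha hb => by rw [Pi.smul_apply, Pi.smul_apply, hx.1 a b ha hb]; simp,
        fun a b hab h => by rw [Pi.smul_apply, hx.2 a b hab h, smul_zero]⟩

/-- **The corner centre is admissible with `r = m - 1`**: a matrix that is skew on the three letters and block
upper/lower-free with a diagonal complement is singular (its determinant is `det(3 × 3 skew) · det(diagonal) = 0`),
hence has rank `≤ m - 1`. [folklore] -/
theorem cornerCentre_rank_le (k : ℕ) :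
    ∀ u ∈ Submodule.span ℂ {u : MatIdx (3 + k) → ℂ |
        (∀ a b : Fin (3 + k), (a : ℕ) < 3 → (b : ℕ) < 3 → u (toLex (a, b)) = -u (toLex (b, a))) ∧
        (∀ a b : Fin (3 + k), a ≠ b → (3 ≤ (a : ℕ) ∨ 3 ≤ (b : ℕ)) → u (toLex (a, b)) = 0)},
      (Matrix.of fun a b : Fin (3 + k) => u (toLex (a, b))).rank ≤ 3 + k - 1 := by
  intro u hu
  obtain ⟨h1, h2⟩ := frc_cond_of_mem_cornerCentre hu
  refine frc_rank_le_of_det_eq_zero _ ?_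
  set M : Matrix (Fin (3 + k)) (Fin (3 + k)) ℂ := Matrix.of fun a b : Fin (3 + k) => u (toLex (a, b)) with hM
  set M' : Matrix (Fin 3 ⊕ Fin k) (Fin 3 ⊕ Fin k) ℂ := M.submatrix finSumFinEquiv finSumFinEquiv with hM'
  have hdet : M.det = M'.det := (Matrix.det_submatrix_equiv_self finSumFinEquiv M).symm
  have hC : M'.toBlocks₂₁ = 0 := by
    ext j i
    simp only [Matrix.toBlocks₂₁, hM', hM, Matrix.of_apply, Matrix.submatrix_apply, finSumFinEquiv_apply_right,
      finSumFinEquiv_apply_left, Matrix.zero_apply]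
    refine h2 _ _ ?_ (Or.inl (by simp))
    intro h
    have := congrArg Fin.val h
    simp at this
    omega
  have hblocks : M' = Matrix.fromBlocks M'.toBlocks₁₁ M'.toBlocks₁₂ 0 M'.toBlocks₂₂ := by
    rw [← hC]
    exact (Matrix.fromBlocks_toBlocks M').symm
  have hskew : ∀ i j : Fin 3, M'.toBlocks₁₁ i j = -M'.toBlocks₁₁ j i := by
    intro i j
    simp only [Matrix.toBlocks₁₁, hM', hM, Matrix.of_apply, Matrix.submatrix_apply, finSumFinEquiv_apply_left]
    exact h1 _ _ (by simp) (by simp)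
  rw [hdet, hblocks, Matrix.det_fromBlocks_zero₂₁, frc_det_eq_zero_of_skew (by decide) _ hskew, zero_mul]

/-- **The cut bites at the first rung along `Λ_3 ⊕ D_{m-3}`, for EVERY `m ≥ 3`** (odd and even): there is
`λ ⊢ 2m` (`≤ m²` parts) with `finrank T_U(t, λ*) < finrank T_U(0, λ*)` for every `t ≥ 1`, `U` the corner centre.
Certificate: `firstRung_bite_of_mem` with `e = finSumFinEquiv`, `κ = Fin (m - 3)`, `Y = 1`. [folklore] -/
theorem firstRung_bite_cornerCentre (m : ℕ) (h3 : 3 ≤ m) :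
    ∃ lam : Nat.Partition (m * 2), lam.parts.card ≤ m * m ∧
      (let U : Submodule ℂ (MatIdx m → ℂ) :=
        Submodule.span ℂ {u : MatIdx m → ℂ |
          (∀ a b : Fin m, (a : ℕ) < 3 → (b : ℕ) < 3 → u (toLex (a, b)) = -u (toLex (b, a))) ∧
          (∀ a b : Fin m, a ≠ b → (3 ≤ (a : ℕ) ∨ 3 ≤ (b : ℕ)) → u (toLex (a, b)) = 0)};
      let χ : Weight (MatIdx m) := (Weight.dualOfPartition (m * m) lam).toMatIdx;
      let T : ℕ → Submodule ℂ (MvPolynomial (MatIdx m × MatIdx m) ℂ) := fun t =>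
        MvPolynomial.homogeneousSubmodule (MatIdx m × MatIdx m) ℂ (m * 2)
        ⊓ ((MvPolynomial.vanishingIdeal ℂ {p : MatIdx m × MatIdx m → ℂ |
              ∀ j : MatIdx m, (fun i => p (j, i)) ∈ U}) ^ (t)).restrictScalars ℂ
        ⊓ (⨅ (M : Matrix (MatIdx m) (MatIdx m) ℂ)
            (_ : linSubst (MatIdx m) ℂ M (detFormLex ℂ m) = detFormLex ℂ m),
            LinearMap.ker ((MvPolynomial.aeval (R := ℂ) fun p : MatIdx m × MatIdx m =>
              ∑ l : MatIdx m, M l p.2 • MvPolynomial.X (p.1, l)).toLinearMap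
              - LinearMap.id (R := ℂ) (M := MvPolynomial (MatIdx m × MatIdx m) ℂ)))
        ⊓ (⨅ (g : Matrix.GeneralLinearGroup (MatIdx m) ℂ) (_ : IsUpperTriangular g),
            LinearMap.ker ((MvPolynomial.aeval (R := ℂ) fun p : MatIdx m × MatIdx m =>
              ∑ l : MatIdx m, ((g⁻¹ : Matrix.GeneralLinearGroup (MatIdx m) ℂ) :
                Matrix (MatIdx m) (MatIdx m) ℂ) p.1 l • MvPolynomial.X (l, p.2)).toLinearMap
              - weightChar χ g • LinearMap.id (R := ℂ) (M := MvPolynomial (MatIdx m × MatIdx m) ℂ)));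
      ∀ t : ℕ, 0 < t → Module.finrank ℂ ↥(T t) < Module.finrank ℂ ↥(T 0)) := by
  obtain ⟨k, rfl⟩ := Nat.exists_eq_add_of_le h3
  have hA : ∀ (A : Matrix (Fin 3) (Fin 3) ℂ), Aᵀ = -A → ∀ i j, A i j = -A j i := fun A hA i j => by
    have := congr_fun (congr_fun hA j) i
    simpa only [Matrix.transpose_apply, Matrix.neg_apply] using this
  have h0 : ∀ i j : Fin k, i ≠ j → (0 : Matrix (Fin k) (Fin k) ℂ) i j = 0 := fun _ _ _ => rfl
  have h1 : ∀ i j : Fin k, i ≠ j → (1 : Matrix (Fin k) (Fin k) ℂ) i j = 0 := fun _ _ h => Matrix.one_apply_ne h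
  have hz : ∀ i j : Fin 3, (0 : Matrix (Fin 3) (Fin 3) ℂ) i j = -(0 : Matrix (Fin 3) (Fin 3) ℂ) j i := by simp
  obtain ⟨lam, hcard, hlt⟩ := firstRung_bite_of_mem finSumFinEquiv (1 : Matrix (Fin k) (Fin k) ℂ)
    (by rw [Matrix.det_one]; exact one_ne_zero) _
    (frc_mem_cornerCentre (hA _ frc_sP_transpose) h0) (frc_mem_cornerCentre (hA _ frc_sQ_transpose) h0)
    (frc_mem_cornerCentre (hA _ frc_sR_transpose) h0) (frc_mem_cornerCentre hz h1)
  exact ⟨lam, hcard, hlt⟩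

/-! ### §4 In the crux's own currency: at every `m ≥ 3` an ADMISSIBLE centre cuts the census strictly at `δ = 2` -/

/-- **First-rung bite in the crux's currency.**  For every `m ≥ 3` (odd or even) there are an admissible centre
`(U, r)` of the crux `ValuativeFlip` — every `u ∈ U` of rank `≤ r`, `r < m` — and a shape `λ ⊢ m · 2` (`≤ m²`
parts) such that the crux's valuative truncation at its own threshold `δ (m - r)` (here `δ = 2`, `r = m - 1`,
threshold `2`) is STRICTLY smaller than the untruncated census space `T_U(0, λ*)` (= the symmetric Kronecker space
`T_⊥(λ)`, `stabInv_eq_explicit`): `finrank T_U(2(m-r), λ*) < finrank T_U(0, λ*)`.  Witness centre: the corner centre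
`Λ_3 ⊕ D_{m-3}` (`cornerCentre_rank_le`, `firstRung_bite_cornerCentre`).  So the route's lever is non-vacuous at
every size in the lowest degree where the census exceeds the closure count `K_m` (which equals the two-row part
in degree `2`). [folklore] -/
theorem firstRung_admissibleCentre_bites (m : ℕ) (h3 : 3 ≤ m) :
    ∃ (U : Submodule ℂ (MatIdx m → ℂ)) (r : ℕ),
      (∀ u ∈ U, (Matrix.of fun a b : Fin m => u (toLex (a, b))).rank ≤ r) ∧ r < m ∧
      ∃ lam : Nat.Partition (m * 2), lam.parts.card ≤ m * m ∧
      (let χ : Weight (MatIdx m) := (Weight.dualOfPartition (m * m) lam).toMatIdx;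
      let T : ℕ → Submodule ℂ (MvPolynomial (MatIdx m × MatIdx m) ℂ) := fun t =>
        MvPolynomial.homogeneousSubmodule (MatIdx m × MatIdx m) ℂ (m * 2)
        ⊓ ((MvPolynomial.vanishingIdeal ℂ {p : MatIdx m × MatIdx m → ℂ |
              ∀ j : MatIdx m, (fun i => p (j, i)) ∈ U}) ^ (t)).restrictScalars ℂ
        ⊓ (⨅ (M : Matrix (MatIdx m) (MatIdx m) ℂ)
            (_ : linSubst (MatIdx m) ℂ M (detFormLex ℂ m) = detFormLex ℂ m),
            LinearMap.ker ((MvPolynomial.aeval (R := ℂ) fun p : MatIdx m × MatIdx m =>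
              ∑ l : MatIdx m, M l p.2 • MvPolynomial.X (p.1, l)).toLinearMap
              - LinearMap.id (R := ℂ) (M := MvPolynomial (MatIdx m × MatIdx m) ℂ)))
        ⊓ (⨅ (g : Matrix.GeneralLinearGroup (MatIdx m) ℂ) (_ : IsUpperTriangular g),
            LinearMap.ker ((MvPolynomial.aeval (R := ℂ) fun p : MatIdx m × MatIdx m =>
              ∑ l : MatIdx m, ((g⁻¹ : Matrix.GeneralLinearGroup (MatIdx m) ℂ) :
                Matrix (MatIdx m) (MatIdx m) ℂ) p.1 l • MvPolynomial.X (l, p.2)).toLinearMap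
              - weightChar χ g • LinearMap.id (R := ℂ) (M := MvPolynomial (MatIdx m × MatIdx m) ℂ)));
      Module.finrank ℂ ↥(T (2 * (m - r))) < Module.finrank ℂ ↥(T 0)) := by
  obtain ⟨k, rfl⟩ := Nat.exists_eq_add_of_le h3
  obtain ⟨lam, hcard, hlt⟩ := firstRung_bite_cornerCentre (3 + k) h3
  refine ⟨_, 3 + k - 1, cornerCentre_rank_le k, by omega, lam, hcard, ?_⟩
  have h2 : 2 * (3 + k - (3 + k - 1)) = 2 := by omega
  dsimp only at hlt ⊢
  rw [h2]
  exact hlt 2 two_pos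


end

end Summit.ValiantsHypothesis.ValiantsHypothesis.Theorems.ValuativeFlip
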